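import Mathlib

/-!
# Normal form of a second-level relation — crux stmt-Schanuel-0969 `RigidCore.MinimalCounterexampleInAcl`

Line `kernel-arithmetic-selection`, stub `stub_relationNormalForm` (skeleton gen 19), `--supports stmt-Schanuel-0969`.

Pure algebra. For `x : Fin 2 → ℂ` put `K = ℚ(x, eˣ) = IntermediateField.adjoin ℚ S`,
`S = range x ∪ range (cexp ∘ x) = range (Sum.elim x (cexp ∘ x))`. If `E ≠ 0` is algebraic over `K`, then there
are `ℚ`-polynomials `c₀, …, c_d` in the four variables `Fin 2 ⊕ Fin 2` (`inl i ↦ xᵢ`, `inr i ↦ e^{xᵢ}`) with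
`Σ_j c_j(x, eˣ) E^j = 0` and `c₀(x, eˣ) ≠ 0`.

Proof: `K` is the fraction field of `A = ℚ[x, eˣ] = Algebra.adjoin ℚ S` (Mathlib's scoped instances
`IntermediateField.algebraAdjoinAdjoin`), so `E` is algebraic over `A` (`IsFractionRing.isAlgebraic_iff`); an
annihilating `P ∈ A[T]`, mapped to `ℂ[T]`, has coefficients in `A = range (MvPolynomial.aeval (x, eˣ))`
(`Algebra.adjoin_range_eq_range_aeval`); write `P = T^m · Q` with `T ∤ Q`
(`Polynomial.exists_eq_pow_rootMultiplicity_mul_and_not_dvd`), so `Q(E) = 0` (as `E ≠ 0`) and `Q(0) ≠ 0`;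
the coefficients of `Q` are those of `P` shifted by `m`.
-/

noncomputable section

set_option linter.dupNamespace false

open Complex Set Polynomial

namespace Summit.Schanuel.Schanuel.Cruxes.MinimalCounterexampleInAcl.KernelArithmeticSelection

open scoped IntermediateField.algebraAdjoinAdjoin

/-- An element of `ℂ` algebraic over the field `ℚ(S)`, `S = range v`, is a root of a non-zero polynomial whose
coefficients are `ℚ`-polynomial expressions in `v`; after dividing off the largest power of the variable, the
constant coefficient is non-zero. [folklore] -/
theorem exists_aeval_coeffs_of_isAlgebraic_adjoin {σ : Type*} (v : σ → ℂ) {E : ℂ} (hE : E ≠ 0)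
    (halg : IsAlgebraic (IntermediateField.adjoin ℚ (range v)) E) :
    ∃ (d : ℕ) (c : Fin (d + 1) → MvPolynomial σ ℚ), MvPolynomial.aeval v (c 0) ≠ 0 ∧
      ∑ j : Fin (d + 1), MvPolynomial.aeval v (c j) * E ^ (j : ℕ) = 0 := by
  classical
  -- Step 1: `E` is algebraic over the ring `A = ℚ[v]`, whose fraction field is `ℚ(v)`.
  have halgA : IsAlgebraic (Algebra.adjoin ℚ (range v)) E :=
    (IsFractionRing.isAlgebraic_iff (Algebra.adjoin ℚ (range v))
      (IntermediateField.adjoin ℚ (range v)) ℂ).2 halg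
  obtain ⟨P, hP0, hPE⟩ := halgA
  -- Step 2: map the annihilating polynomial to `ℂ[T]`; its coefficients are values of `ℚ`-polynomials at `v`.
  have hinj : Function.Injective (algebraMap (Algebra.adjoin ℚ (range v)) ℂ) := Subtype.val_injective
  set Pc : ℂ[X] := P.map (algebraMap (Algebra.adjoin ℚ (range v)) ℂ) with hPc
  have hPc0 : Pc ≠ 0 := (Polynomial.map_ne_zero_iff hinj).2 hP0
  have hPcE : Pc.eval E = 0 := by
    rw [hPc, Polynomial.eval_map, ← Polynomial.aeval_def]; exact hPE
  have hcoef : ∀ i, ∃ q : MvPolynomial σ ℚ, MvPolynomial.aeval v q = Pc.coeff i := by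
    intro i
    have hmem : Pc.coeff i ∈ Algebra.adjoin ℚ (range v) := by
      rw [hPc, Polynomial.coeff_map]; exact (P.coeff i).2
    rw [Algebra.adjoin_range_eq_range_aeval] at hmem
    exact hmem
  choose q hq using hcoef
  -- Step 3: strip the power of `T` dividing `Pc`.
  obtain ⟨Q, hPQ, hXQ⟩ := Polynomial.exists_eq_pow_rootMultiplicity_mul_and_not_dvd Pc hPc0 0
  rw [map_zero, sub_zero] at hPQ hXQ
  generalize Pc.rootMultiplicity 0 = m at hPQ
  have hQ0 : Q.coeff 0 ≠ 0 := fun h => hXQ (Polynomial.X_dvd_iff.2 h)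
  have hQE : Q.eval E = 0 := by
    have h : Pc.eval E = E ^ m * Q.eval E := by
      rw [hPQ, Polynomial.eval_mul, Polynomial.eval_pow, Polynomial.eval_X]
    rw [hPcE] at h
    exact (mul_eq_zero.1 h.symm).resolve_left (pow_ne_zero _ hE)
  have hcQ : ∀ j, Q.coeff j = Pc.coeff (j + m) := by
    intro j
    rw [hPQ, Polynomial.coeff_X_pow_mul]
  refine ⟨Q.natDegree, fun j => q ((j : ℕ) + m), ?_, ?_⟩
  · rw [hq, Fin.val_zero, ← hcQ]
    exact hQ0
  · calc ∑ j : Fin (Q.natDegree + 1), MvPolynomial.aeval v (q ((j : ℕ) + m)) * E ^ (j : ℕ)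
        = ∑ j ∈ Finset.range (Q.natDegree + 1), Q.coeff j * E ^ j := by
          rw [← Fin.sum_univ_eq_sum_range (fun j => Q.coeff j * E ^ j)]
          refine Finset.sum_congr rfl fun j _ => ?_
          rw [hq, hcQ]
      _ = Q.eval E := (Polynomial.eval_eq_sum_range E).symm
      _ = 0 := hQE

/-- **Normal form of a second-level relation.** If `E ≠ 0` is algebraic over `K = ℚ(x, eˣ)` (`x : Fin 2 → ℂ`),
then there are `ℚ`-polynomials `c₀, …, c_d` in the four variables `(x, eˣ)` with `Σ_j c_j(x, eˣ) E^j = 0` and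
`c₀(x, eˣ) ≠ 0`. [folklore] -/
theorem stub_relationNormalForm : ∀ (x : Fin 2 → ℂ) (E : ℂ), E ≠ 0 → IsAlgebraic ↥(IntermediateField.adjoin ℚ (Set.range x ∪ Set.range (Complex.exp ∘ x))) E → ∃ (d : ℕ) (c : Fin (d + 1) → MvPolynomial (Fin 2 ⊕ Fin 2) ℚ), MvPolynomial.aeval (Sum.elim x (Complex.exp ∘ x)) (c 0) ≠ 0 ∧ ∑ j : Fin (d + 1), MvPolynomial.aeval (Sum.elim x (Complex.exp ∘ x)) (c j) * E ^ (j : ℕ) = 0 := by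
  intro x E hE halg
  rw [← Set.Sum.elim_range] at halg
  exact exists_aeval_coeffs_of_isAlgebraic_adjoin (Sum.elim x (Complex.exp ∘ x)) hE halg

end Summit.Schanuel.Schanuel.Cruxes.MinimalCounterexampleInAcl.KernelArithmeticSelection
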